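import Literature.MathematicalPhysics.QuantumFieldTheory.Balaban1983to89.B5Action121
import Summits.QuantumFields.BalabanUV.Beta.GAN24.ChainLeibniz

/-!
# `BalabanUV.Beta.GAN24.ChainLeibnizGrad` — binder row G-an2-4 ∕ (CONV-C), route R7 «TWO CURRENCIES», step S4 in the DEMOTED currency
# for a local vertex WITH ONE LATTICE DERIVATIVE ON A LEG (the SHAPE of Bałaban's cubic table `S‴(0)[h,h,h]` ∕ AN1 Table T row T1:
# `Σ_x (∇_ν f)(x)·g(x)·h(x)`, one derivative, three columns): SUMMATION BY PARTS moves the derivative OFF the differenced leg, so the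
# differenced leg is ALWAYS taken in `ℓ²` — «never difference the derivative leg in ℓ²» (P-R7f) costs NO gradient sup letter

NOT IN PRINT; OUR PROOF ATTEMPT (prover part P3 of row G-an2-4, fibre∕strip («Woodbury») lineage, gen 25; CRUX TEAM (2), ruling «YM
REDIRECT TOWARDS THE SUMMIT», 2026-08-21).  HONEST DEPENDENCY (cell records, verbatim): «continuum YM on T⁴ ⇐ BetaPertH ∧ nine spine
estimates (0/9 proved); BetaPertH ⇐ (D1) ∧ (D4) ∧ CAP+tail; G-an2-4 gates asym, D1 and NE2/3/4.»  HONEST FRAMING (cell contract, verbatim):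
«discharging `BetaPertH` makes Bałaban's UV stability UNCONDITIONAL — a real constructive-QFT result; it is NOT the continuum limit and NOT
the Clay problem.»  ABSOLUTE RULE: nothing printed is a hypothesis; no `def … : Prop`, no sorry.  [folklore] finite-dimensional algebra.

## Why (refuter PRICING-GAN24 v3.7 check #38 (c) and idea-1 ROUTES-GAN24 v7 «→ gan24-p3 g25»: «T1's cubic row carries ONE lattice
## derivative, so (C) models it only with the second sup letter `hcol′` ((1.65) gradient clause) + one summation by parts per derivative leg»)

The summation by parts is EXACT and, on the torus, FREE: for fields on `Tor Nf × Fin d` and b05's vector-index forward difference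
`fdiff Nf c ν = c·(S_ν − 1)` (`B5Prop11Plancherel.fdiff`, [B5] (1.31)),
  **`vtx₃_fdiff_left`**: `vtx₃ C (∇_ν δ) g h = − vtx₃ C δ (τ_ν(∇_ν g)) (τ_ν h) − vtx₃ C δ g (τ_ν(∇_ν h))`
with `τ_ν` the backward shift `(τ_ν u)(x,i) = u(x − e_ν, i)` (`bsh`; it preserves `nsq` and every sup letter).  Hence
(**`norm_vtx₃_fdiff_left_le`**) when the DIFFERENCED leg `δ` carries the derivative, the bound is
`‖vtx₃ C (∇δ) g h‖ ≤ ‖C‖₁·√(nsq δ)·(B_h·√(nsq ∇g) + B_g·√(nsq ∇h))` — `δ` in `ℓ²` (the RATE), the neighbours through their ZEROTH-order sup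
letters `B_g, B_h` and the `ℓ²` norms of THEIR gradients (for Bałaban's soft columns these are `‖∇𝒢‖ ≤ Cst`, (1.89), TREE) — NO gradient sup
letter.  When an UNdifferenced leg carries the derivative, `ChainLeibniz.norm_vtx₃_le_mid∕_le_right` apply verbatim with `∇f` in an `ℓ²`
slot.  Consumer: `GAN24/SoftColumnGradVertexRate` (the instance on NE2-P1's `U = 1` tower, where moreover the staircase transport of the
gradient vertex is EXACT: `Σ_{x′}(∇′J f)(J g)(J h) ∝ Σ_x (∇f) g h` by the far-face count).

 * §1 `bsh` (backward shift), `nsq_bsh`, `norm_bsh_le`; `fdiff_mulVec_pt` (`(∇_ν u)(x,i) = c·(u(x+e_ν,i) − u(x,i))`), `bsh_fdiff_mulVec_pt`;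
 * §2 the scalar summation by parts `sum_fdiff_mul` and **`vtx₃_fdiff_left`**;
 * §3 **`norm_vtx₃_fdiff_left_le`**.

NEVER «G-an2-4 closed»; NOT (CONV-C), NOT D1, NOT BetaPertH, NOT continuum, NOT Clay.  Provenance: prover-b2b-balaban-gan24-p3-g25-0
(unit `b2b-balaban-gan24-p3`, gen 25), 2026-08-21.
-/

noncomputable section

open scoped BigOperators ComplexConjugate Matrix Matrix.Norms.L2Operator
open Finset

namespace Summit.QuantumFields.BalabanUV.Beta.GAN24.ChainLeibnizGrad

open Literature.MathematicalPhysics.QuantumFieldTheory.Balaban1983to89.B5Prop11Plancherel (Tor unitVec shiftM fdiff)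
open Literature.MathematicalPhysics.QuantumFieldTheory.Balaban1983to89.B5Prop11Lower (nsq nsq_nonneg)
open Literature.MathematicalPhysics.QuantumFieldTheory.Balaban1983to89.B5Action121 (shiftM_mulVec)
open Summit.QuantumFields.BalabanUV.Beta.GAN24.ChainLeibniz

variable {d : ℕ} (Nf : Fin d → ℕ) [hNf : ∀ μ, NeZero (Nf μ)]

/-! ## §1 The backward shift and the pointwise forward difference -/

/-- the backward shift `(τ_ν u)(x, i) = u(x − e_ν, i)`. [folklore] -/
def bsh (ν : Fin d) (u : Tor Nf × Fin d → ℂ) : Tor Nf × Fin d → ℂ := fun X => u (X.1 - unitVec Nf ν, X.2)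

/-- the site shift `(x, i) ↦ (x + e_ν, i)` as an equivalence. [folklore] -/
def shiftEquiv (ν : Fin d) : (Tor Nf × Fin d) ≃ (Tor Nf × Fin d) :=
  Equiv.prodCongr (Equiv.addRight (unitVec Nf ν)) (Equiv.refl _)

/-- `nsq (τ_ν u) = nsq u` (reindex the torus sum). [folklore] -/
theorem nsq_bsh (ν : Fin d) (u : Tor Nf × Fin d → ℂ) : nsq (bsh Nf ν u) = nsq u := by
  rw [nsq, nsq]
  rw [← (shiftEquiv Nf ν).sum_comp (fun X => ‖bsh Nf ν u X‖ ^ 2)]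
  refine Finset.sum_congr rfl fun X _ => ?_
  simp only [shiftEquiv, bsh, Equiv.prodCongr_apply, Prod.map, Equiv.coe_addRight, Equiv.coe_refl, id_eq,
    add_sub_cancel_right]

omit hNf in
/-- a sup letter passes to the shifted field. [folklore] -/
theorem norm_bsh_le (ν : Fin d) {u : Tor Nf × Fin d → ℂ} {B : ℝ} (hu : ∀ z, ‖u z‖ ≤ B) (z : Tor Nf × Fin d) :
    ‖bsh Nf ν u z‖ ≤ B := hu _

/-- **the forward difference, pointwise**: `(∇_ν u)(x, i) = c·(u(x + e_ν, i) − u(x, i))`. [cite: Balaban1984PropagatorsI, (1.31) p.23]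
[folklore] -/
theorem fdiff_mulVec_pt (c : ℂ) (ν : Fin d) (u : Tor Nf × Fin d → ℂ) (X : Tor Nf × Fin d) :
    (fdiff Nf c ν *ᵥ u) X = c * (u (X.1 + unitVec Nf ν, X.2) - u X) := by
  obtain ⟨x, i⟩ := X
  simp only [fdiff, Matrix.smul_mulVec, Matrix.sub_mulVec, Matrix.one_mulVec, Pi.smul_apply, Pi.sub_apply, shiftM_mulVec,
    smul_eq_mul]

/-- the shifted forward difference: `(τ_ν ∇_ν u)(x, i) = c·(u(x, i) − u(x − e_ν, i))`. [folklore] -/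
theorem bsh_fdiff_mulVec_pt (c : ℂ) (ν : Fin d) (u : Tor Nf × Fin d → ℂ) (X : Tor Nf × Fin d) :
    bsh Nf ν (fdiff Nf c ν *ᵥ u) X = c * (u X - u (X.1 - unitVec Nf ν, X.2)) := by
  rw [bsh, fdiff_mulVec_pt, sub_add_cancel]

/-! ## §2 Summation by parts -/

/-- **summation by parts on the torus** (one component slice): `Σ_x (a(x+e) − a(x))·b(x) = Σ_x a(x)·(b(x−e) − b(x))`. [folklore] -/
theorem sum_fdiff_mul (ν : Fin d) (a b : Tor Nf → ℂ) :
    ∑ x, (a (x + unitVec Nf ν) - a x) * b x = ∑ x, a x * (b (x - unitVec Nf ν) - b x) := by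
  have h1 : ∑ x, a (x + unitVec Nf ν) * b x = ∑ x, a x * b (x - unitVec Nf ν) := by
    rw [← Equiv.sum_comp (Equiv.addRight (unitVec Nf ν)) (fun x => a x * b (x - unitVec Nf ν))]
    simp only [Equiv.coe_addRight, add_sub_cancel_right]
  simp only [sub_mul, mul_sub, Finset.sum_sub_distrib, h1]

/-- the component-wise form of `vtx₃`: `vtx₃ C f g h = Σ_{ijl} C i j l·Σ_x f(x,i)g(x,j)h(x,l)`. [folklore] -/
theorem vtx₃_eq_sum {κ α : Type*} [Fintype κ] [Fintype α] (C : κ → κ → κ → ℂ) (f g h : α × κ → ℂ) :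
    vtx₃ C f g h = ∑ i, ∑ j, ∑ l, C i j l * ∑ x, f (x, i) * g (x, j) * h (x, l) := by
  rw [vtx₃, Finset.sum_comm]
  refine Finset.sum_congr rfl fun i _ => ?_
  rw [Finset.sum_comm]
  refine Finset.sum_congr rfl fun j _ => ?_
  rw [Finset.sum_comm]
  refine Finset.sum_congr rfl fun l _ => ?_
  rw [Finset.mul_sum]

/-- **SUMMATION BY PARTS FOR THE GRADIENT VERTEX (exact)**:
`vtx₃ C (∇_ν δ) g h = − vtx₃ C δ (τ_ν(∇_ν g)) (τ_ν h) − vtx₃ C δ g (τ_ν(∇_ν h))` — the derivative leaves the differenced leg. [folklore] -/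
theorem vtx₃_fdiff_left (C : Fin d → Fin d → Fin d → ℂ) (c : ℂ) (ν : Fin d) (δ g h : Tor Nf × Fin d → ℂ) :
    vtx₃ C (fdiff Nf c ν *ᵥ δ) g h
      = -vtx₃ C δ (bsh Nf ν (fdiff Nf c ν *ᵥ g)) (bsh Nf ν h) - vtx₃ C δ g (bsh Nf ν (fdiff Nf c ν *ᵥ h)) := by
  -- per component triple `(i, j, l)`
  have key : ∀ i j l : Fin d,
      C i j l * ∑ x : Tor Nf, (fdiff Nf c ν *ᵥ δ) (x, i) * g (x, j) * h (x, l)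
        = -(C i j l * ∑ x : Tor Nf, δ (x, i) * bsh Nf ν (fdiff Nf c ν *ᵥ g) (x, j) * bsh Nf ν h (x, l))
          - C i j l * ∑ x : Tor Nf, δ (x, i) * g (x, j) * bsh Nf ν (fdiff Nf c ν *ᵥ h) (x, l) := by
    intro i j l
    have e1 : ∑ x : Tor Nf, (fdiff Nf c ν *ᵥ δ) (x, i) * g (x, j) * h (x, l)
        = c * ∑ x : Tor Nf, (δ (x + unitVec Nf ν, i) - δ (x, i)) * (g (x, j) * h (x, l)) := by
      rw [Finset.mul_sum]
      refine Finset.sum_congr rfl fun x _ => ?_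
      rw [fdiff_mulVec_pt]; ring
    rw [e1, sum_fdiff_mul Nf ν (fun x => δ (x, i)) (fun x => g (x, j) * h (x, l)), Finset.mul_sum, Finset.mul_sum,
      Finset.mul_sum, Finset.mul_sum, ← Finset.sum_neg_distrib, ← Finset.sum_sub_distrib]
    refine Finset.sum_congr rfl fun x _ => ?_
    simp only [bsh, fdiff_mulVec_pt, sub_add_cancel]
    ring
  rw [vtx₃_eq_sum, vtx₃_eq_sum, vtx₃_eq_sum]
  simp only [key, Finset.sum_sub_distrib, Finset.sum_neg_distrib]

/-! ## §3 The demoted bound for the gradient vertex with the derivative on the differenced leg -/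

/-- **THE GRADIENT-VERTEX BOUND, derivative on the differenced leg**: sup letters `B_g, B_h ≥ 0` on the neighbours (ZEROTH order),
`ℓ²` norms of the neighbours' gradients, and the differenced leg `δ` in `ℓ²`:
`‖vtx₃ C (∇_ν δ) g h‖ ≤ ‖C‖₁·(B_h·(√(nsq δ)·√(nsq ∇g)) + B_g·(√(nsq δ)·√(nsq ∇h)))` — NO gradient sup letter. [folklore] -/
theorem norm_vtx₃_fdiff_left_le (C : Fin d → Fin d → Fin d → ℂ) (c : ℂ) (ν : Fin d) (δ g h : Tor Nf × Fin d → ℂ) {Bg Bh : ℝ}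
    (hBg : 0 ≤ Bg) (hBh : 0 ≤ Bh) (hg : ∀ z, ‖g z‖ ≤ Bg) (hh : ∀ z, ‖h z‖ ≤ Bh) :
    ‖vtx₃ C (fdiff Nf c ν *ᵥ δ) g h‖
      ≤ cnorm₃ C * (Bh * (Real.sqrt (nsq δ) * Real.sqrt (nsq (fdiff Nf c ν *ᵥ g)))
          + Bg * (Real.sqrt (nsq δ) * Real.sqrt (nsq (fdiff Nf c ν *ᵥ h)))) := by
  rw [vtx₃_fdiff_left]
  have t1 : ‖vtx₃ C δ (bsh Nf ν (fdiff Nf c ν *ᵥ g)) (bsh Nf ν h)‖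
      ≤ cnorm₃ C * (Bh * (Real.sqrt (nsq δ) * Real.sqrt (nsq (fdiff Nf c ν *ᵥ g)))) := by
    have h := norm_vtx₃_le_right C δ (bsh Nf ν (fdiff Nf c ν *ᵥ g)) (bsh Nf ν h) hBh (norm_bsh_le Nf ν hh)
    rwa [nsq_bsh] at h
  have t2 : ‖vtx₃ C δ g (bsh Nf ν (fdiff Nf c ν *ᵥ h))‖
      ≤ cnorm₃ C * (Bg * (Real.sqrt (nsq δ) * Real.sqrt (nsq (fdiff Nf c ν *ᵥ h)))) := by
    have h := norm_vtx₃_le_mid C δ g (bsh Nf ν (fdiff Nf c ν *ᵥ h)) hBg hg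
    rwa [nsq_bsh] at h
  calc _ ≤ ‖-vtx₃ C δ (bsh Nf ν (fdiff Nf c ν *ᵥ g)) (bsh Nf ν h)‖ + ‖vtx₃ C δ g (bsh Nf ν (fdiff Nf c ν *ᵥ h))‖ :=
        norm_sub_le _ _
    _ ≤ cnorm₃ C * (Bh * (Real.sqrt (nsq δ) * Real.sqrt (nsq (fdiff Nf c ν *ᵥ g))))
          + cnorm₃ C * (Bg * (Real.sqrt (nsq δ) * Real.sqrt (nsq (fdiff Nf c ν *ᵥ h)))) := by
        rw [norm_neg]; exact add_le_add t1 t2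
    _ = _ := by ring

end Summit.QuantumFields.BalabanUV.Beta.GAN24.ChainLeibnizGrad

end
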